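import Summits.MatrixMultiplication.MatrixMultiplication.Theses.ObstructionDescent

/-!
# ObstructionDescent — block reduction (gen 11, mechanism H10)

The aside `BlockLinearSaturation` (item 33327, route rev 7: linear-scale saturation of the invariant
tower, `m ≥ c·N`) implies the aside `InvariantSaturation` (item 32282, scale `m ≥ n^τ`, `τ > 2`):
for `τ > 2` one has `c·n² ≤ n^τ` eventually, and the tower predicate of `InvariantSaturation` is the
`N := n·n` instance of the one in `BlockLinearSaturation`.  Inter-item reduction; credits nothing by
itself (both items are open asides).  [bookkeeping · this node]
-/

set_option linter.dupNamespace false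

open Filter

namespace Summit.MatrixMultiplication.MatrixMultiplication.Theorems.ObstructionDescentBlockReduction

open Summit.MatrixMultiplication.MatrixMultiplication.Theses.ObstructionDescent

/-- For `τ > 2` and any natural `c`, eventually `c·n² ≤ n^τ`. [bookkeeping] -/
theorem eventually_linear_le_rpow (c : ℕ) {τ : ℝ} (hτ : 2 < τ) :
    ∃ n₀ : ℕ, ∀ n : ℕ, n₀ ≤ n → ((c * (n * n) : ℕ) : ℝ) ≤ (n : ℝ) ^ τ := by
  have ht : Tendsto (fun n : ℕ => (n : ℝ) ^ (τ - 2)) atTop atTop :=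
    (tendsto_rpow_atTop (by linarith)).comp tendsto_natCast_atTop_atTop
  obtain ⟨N', hN'⟩ := eventually_atTop.1 (ht.eventually_ge_atTop (c : ℝ))
  refine ⟨max N' 1, fun n hn => ?_⟩
  have hnN' : N' ≤ n := le_trans (le_max_left _ _) hn
  have hn1 : (1 : ℝ) ≤ n := by exact_mod_cast le_trans (le_max_right _ _) hn
  have hpos : (0 : ℝ) < n := by linarith
  have hc : (c : ℝ) ≤ (n : ℝ) ^ (τ - 2) := hN' n hnN'
  have hsplit : (n : ℝ) ^ τ = (n : ℝ) ^ (2 : ℕ) * (n : ℝ) ^ (τ - 2) := by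
    rw [← Real.rpow_natCast, ← Real.rpow_add hpos]
    norm_num
  rw [hsplit]
  have h2 : (0 : ℝ) ≤ (n : ℝ) ^ (2 : ℕ) := by positivity
  calc ((c * (n * n) : ℕ) : ℝ) = (n : ℝ) ^ (2 : ℕ) * c := by push_cast; ring
    _ ≤ (n : ℝ) ^ (2 : ℕ) * (n : ℝ) ^ (τ - 2) := by gcongr

/-- **H10 reduction.** The aside `BlockLinearSaturation` (linear scale `m ≥ c·N`, every corner format `N`)
implies the aside `InvariantSaturation` (scale `m ≥ n^τ`, corner formats `N = n²`). [this node] -/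
theorem invariantSaturation_of_blockLinearSaturation (H : BlockLinearSaturation) :
    InvariantSaturation := by
  obtain ⟨c, hc⟩ := H
  intro τ hτ _hτ4
  obtain ⟨n₀, hn₀⟩ := eventually_linear_le_rpow c hτ
  refine ⟨max n₀ 1, ?_⟩
  intro n m hn hnm hτm k _hk W hW hvan
  have hn0 : n₀ ≤ n := le_trans (le_max_left _ _) hn
  have hn1 : 1 ≤ n := le_trans (le_max_right _ _) hn
  have hN1 : 1 ≤ n * n := Nat.one_le_iff_ne_zero.mpr (Nat.mul_ne_zero (by omega) (by omega))
  have hcm : c * (n * n) ≤ m := by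
    have h := le_trans (hn₀ n hn0) hτm
    exact_mod_cast h
  exact hc (n * n) m hN1 hcm k W hW hvan

end Summit.MatrixMultiplication.MatrixMultiplication.Theorems.ObstructionDescentBlockReduction
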